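import Summits.CriticalPhenomena.PercolationContinuityZ3.Theorems.PercNearOneGluingNoHeavyLowerTailSahiSlotPatternFace

/-!
# Every term of the pattern functional is a Sahi functional of coordinate indicators under a SIGNED unit-mass weight

Support file (lane `prim-masterthm-p3`, generation 18; `--supports stmt-CriticalPhenomena-4575`).  Pure proofs; the only definitions
are the bookkeeping ones of the weight (`coordInd`, `repWeight`); no `sorry`, standard axioms.

For a family `h : Fin m → X → ℝ` and ANY point assignment `p : Fin m → X` let `W(O) = Π_{i∈O} h_i(p_{min O})` (`blockW`, with
`W(∅) = 1`).  The Möbius transform `repWeight h p = mobius W` is a signed weight of total mass `1` on the Boolean lattice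
`Finset (Fin m)` whose joint moments of the COORDINATE INDICATORS `coordInd i (S) = [i ∈ S]` are exactly the block products:
`E[Π_{i∈O} coordInd i] = W(O)` (`ex_prod_coordInd`).  Consequently (`prod_rep_eq_cycleE_repWeight`, `repSum_eq_sahiE`)
  `Σ_σ (−1)^{C_σ−1} Π_i h_i(p_{rep σ i}) = E_m^{repWeight h p}(coordInd)`,
and for `p = τ·diag` (`diagForm_comp_act_eq_sahiE`):
  **`diagForm d m (h ∘ τ) = sahiE (repWeight h (k ↦ τ·diag k)) m coordInd`** for every relabelling `τ ∈ S_m^d`,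
so `patternForm d m h = Σ_τ sahiE (repWeight h (τ·diag)) m coordInd` (`patternForm_eq_sum_sahiE`): every identity or sign theorem
for Sahi's `E_m` that holds for ALL SIGNED weights (block expansions, the absorbed-member theorem, the Lieb–Sahi recursion, the
absorbing-slot identity `sahiE_cons_of_absorbing`, …) can be applied TERMWISE to the pattern functional (with the caveat that POINTWISE hypotheses on the functions — e.g. an absorbing
head — must be re-established on the Boolean lattice, as `…SahiSlotPatternFace` does with one extra atom).  The slot face theorem
is the first instance; this file records the general dictionary. [this work]
-/

namespace Summit.CriticalPhenomena.PercolationContinuityZ3.Theorems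

open Finset Function Equiv Equiv.Perm
open Literature.Combinatorics.Sahi2008 Literature.Combinatorics.Sahi2008.CycleForm

namespace SahiSlot

section SignedWeight

open scoped Classical

variable {m : ℕ} {X : Type*} (h : Fin m → X → ℝ) (p : Fin m → X)

/-- The block set function with `W(∅) = 1`: `W(O) = Π_{i∈O} h_i(p_{min O})`. [this work] -/
noncomputable def blockW1 (O : Finset (Fin m)) : ℝ :=
  if hO : O.Nonempty then ∏ i ∈ O, h i (p (O.min' hO)) else 1

/-- **The signed weight**: the Möbius transform of the block set function. [this work] -/
noncomputable def repWeight : Finset (Fin m) → ℝ := mobius (blockW1 h p)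

/-- The coordinate indicators on the Boolean lattice: `coordInd i S = [i ∈ S]`. [this work] -/
noncomputable def coordInd (i : Fin m) (S : Finset (Fin m)) : ℝ := if i ∈ S then 1 else 0

/-- A block of coordinate indicators reads `[O ⊆ S]`. [this work] -/
theorem prod_coordInd (O S : Finset (Fin m)) : ∏ i ∈ O, coordInd i S = if O ⊆ S then 1 else 0 := by
  split_ifs with hOS
  · exact prod_eq_one fun i hi => by simp [coordInd, hOS hi]
  · obtain ⟨i, hiO, hiS⟩ := not_subset.1 hOS
    exact prod_eq_zero hiO (by simp [coordInd, hiS])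

/-- **The joint moments of the coordinate indicators are the block products**: `E[Π_{i∈O} coordInd i] = W(O)`. [this work] -/
theorem ex_prod_coordInd (O : Finset (Fin m)) :
    ex (repWeight h p) (fun S => ∏ i ∈ O, coordInd i S) = blockW1 h p O := by
  rw [ex_def]
  simp_rw [prod_coordInd, mul_ite, mul_one, mul_zero]
  rw [← sum_filter]
  exact sum_supset_mobius (blockW1 h p) O

/-- The signed weight has total mass `1` (`= W(∅)`). [this work] -/
theorem sum_repWeight : ∑ S, repWeight h p S = 1 := by
  have h0 := ex_prod_coordInd h p ∅
  simp only [prod_empty, ex_def, mul_one] at h0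
  rw [h0, blockW1, dif_neg (by simp)]

/-- **The cycle product read at least-element representatives is `E_σ` under the signed weight**:
`Π_i h_i(p_{rep σ i}) = cycleE (repWeight h p) coordInd σ`. [this work] -/
theorem prod_rep_eq_cycleE_repWeight (σ : Perm (Fin m)) :
    ∏ i, h i (p (rep σ i)) = cycleE (repWeight h p) coordInd σ := by
  have hfib : ∏ i, h i (p (rep σ i)) = ∏ j, ∏ i ∈ univ.filter (fun i => rep σ i = j), h i (p j) := by
    rw [← Finset.prod_fiberwise_of_maps_to (g := rep σ) (t := univ) (fun i _ => mem_univ _)]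
    refine prod_congr rfl fun j _ => prod_congr rfl fun i hi => ?_
    rw [mem_filter] at hi
    rw [hi.2]
  rw [hfib, ← Finset.prod_filter_mul_prod_filter_not univ (fun j => rep σ j = j)]
  have hnot : ∏ j ∈ univ.filter (fun j => ¬ rep σ j = j), ∏ i ∈ univ.filter (fun i => rep σ i = j), h i (p j) = 1 := by
    refine prod_eq_one fun j hj => ?_
    rw [mem_filter] at hj
    have hemp : univ.filter (fun i => rep σ i = j) = ∅ := by
      rw [Finset.filter_eq_empty_iff]
      intro i _ h
      exact hj.2 (by rw [← h, rep_rep])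
    rw [hemp, prod_empty]
  rw [hnot, mul_one]
  unfold cycleE
  rw [orbits_eq_image_reps, Finset.prod_image (orbit_injOn_reps σ)]
  refine prod_congr rfl fun j hj => ?_
  rw [mem_filter] at hj
  have hfilt : univ.filter (fun i => rep σ i = j) = orbit σ j := by
    ext i
    simp only [mem_filter, mem_univ, true_and, mem_orbit]
    exact rep_eq_iff hj.2 i
  rw [hfilt, ex_prod_coordInd h p (orbit σ j), blockW1, dif_pos ⟨j, self_mem_orbit σ j⟩]
  have hmin : (orbit σ j).min' ⟨j, self_mem_orbit σ j⟩ = j := hj.2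
  rw [hmin]

/-- **The representative form is `E_m` under the signed weight**:
`Σ_σ (−1)^{C_σ−1} Π_i h_i(p_{rep σ i}) = sahiE (repWeight h p) m coordInd` (`1 ≤ m`). [this work] -/
theorem repSum_eq_sahiE (hm : 1 ≤ m) :
    ∑ σ : Perm (Fin m), (-1 : ℝ) ^ ((orbits σ).card - 1) * ∏ i, h i (p (rep σ i)) =
      sahiE (repWeight h p) m coordInd := by
  simp_rw [prod_rep_eq_cycleE_repWeight h p]
  rw [sahiE_eq_sahiECycle _ m hm]
  rfl

end SignedWeight

section Pattern

open scoped Classical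

variable {d n : ℕ}

/-- **Every term of the pattern functional is a Sahi functional under a signed unit-mass weight**:
`diagForm d n (h ∘ τ) = sahiE (repWeight h (k ↦ τ·diag k)) n coordInd` (`1 ≤ n`). [this work] -/
theorem diagForm_comp_act_eq_sahiE (hn : 1 ≤ n) (h : Fin n → Q d n → ℝ) (τ : Fin d → Perm (Fin n)) :
    diagForm d n (fun i => h i ∘ act τ) = sahiE (repWeight h (fun k => act τ (diag k))) n coordInd :=
  repSum_eq_sahiE h (fun k => act τ (diag k)) hn

/-- **The pattern functional as a sum of Sahi functionals under signed weights**: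
`patternForm d n h = Σ_{τ ∈ S_n^d} sahiE (repWeight h (τ·diag)) n coordInd` (`1 ≤ n`). [this work] -/
theorem patternForm_eq_sum_sahiE (hn : 1 ≤ n) (h : Fin n → Q d n → ℝ) :
    patternForm d n h = ∑ τ : Fin d → Perm (Fin n), sahiE (repWeight h (fun k => act τ (diag k))) n coordInd := by
  unfold patternForm
  exact sum_congr rfl fun τ _ => diagForm_comp_act_eq_sahiE hn h τ

end Pattern

end SahiSlot

end Summit.CriticalPhenomena.PercolationContinuityZ3.Theorems
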